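import Mathlib
import Literature.Analysis.ODE.RiccatiCrumShift

/-!
# Crux `UniformPhotonSphereChannelsR` (K1R, stmt-FinalStateConjecture-14074), line
# `crum-peeling-recessive-tower` — stub (R_D ⇒ R): the residual clauses from the shift bounds

The registered stub `stub_residualFromShift` of the line's skeleton v3 (continuation lead c1): the
pure-calculus step turning division-free two-sided bounds on the last recessive Riccati variable
`W = W (ℓ−1)` and its partner potential `U (ℓ−1)` into the three clauses of `stub_residualSubHardy`
for the peeled residual `U ℓ = 2W² − U(ℓ−1)`:

* `U ℓ ≥ 0` on `(a′, ∞)` from `U(ℓ−1) ≤ 2W²` there;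
* `U ℓ` antitone on `[x_f, ∞)` from `(U ℓ)′ = 4W(U(ℓ−1) − W²) − U(ℓ−1)′ ≤ 0` there;
* `t² · U ℓ (x_f + t) ≤ 1/16` from `1/2 ≤ D′`, `1 − D′ ≤ 1/64` on `[x_f, ∞)` (`D = −1/W`,
  `D′ = (U(ℓ−1) − W²)/W²`), via the landed `Literature.Analysis.ODE.sq_mul_crum_next_le`
  (terminal identity `2W² − U = (1 − D′)/D²` and the mean value inequality).
-/

-- `Summit.<S>.<S>` repeats a namespace component by design (D-0017); off here as in the lakefile.
set_option linter.dupNamespace false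

namespace Summit.FinalStateConjecture.FinalStateConjecture.Theorems.CrumPeelingRecessiveTower

open Set

/-- **Stub (R_D ⇒ R).**  Let `ℓ ≥ 1`, let `W (ℓ−1)` solve `W′ = U(ℓ−1) − W²` on `(a, ∞)` and let
`U ℓ = 2 W(ℓ−1)² − U(ℓ−1)` there; let `a ≤ a′ < x_f`.  If `W(ℓ−1) < 0` and `U(ℓ−1) ≤ 2W(ℓ−1)²` on
`(a′, ∞)`, if on `[x_f, ∞)` both `W² ≤ 2(U(ℓ−1) − W²)` and `64(2W² − U(ℓ−1)) ≤ W²`, and if on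
`[x_f, ∞)` the potential `U(ℓ−1)` is differentiable with `4W(U(ℓ−1) − W²) − U(ℓ−1)′ ≤ 0`, then
`U ℓ ≥ 0` on `(a′, ∞)`, `U ℓ` is antitone on `[x_f, ∞)`, and `t²·U ℓ (x_f + t) ≤ 1/16` for `t > 0`. -/
theorem stub_residualFromShift :
    ∀ (W U : ℕ → ℝ → ℝ) (ℓ : ℕ) (a a' xf : ℝ), 1 ≤ ℓ → a ≤ a' → a' < xf →
      (∀ x, a < x → HasDerivAt (W (ℓ - 1)) (U (ℓ - 1) x - W (ℓ - 1) x ^ 2) x) →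
      (∀ x, a < x → U ℓ x = 2 * W (ℓ - 1) x ^ 2 - U (ℓ - 1) x) →
      (∀ x, a' < x → W (ℓ - 1) x < 0 ∧ U (ℓ - 1) x ≤ 2 * W (ℓ - 1) x ^ 2) →
      (∀ x, xf ≤ x →
        W (ℓ - 1) x ^ 2 ≤ 2 * (U (ℓ - 1) x - W (ℓ - 1) x ^ 2) ∧
        64 * (2 * W (ℓ - 1) x ^ 2 - U (ℓ - 1) x) ≤ W (ℓ - 1) x ^ 2) →
      (∀ x, xf ≤ x → ∃ u' : ℝ, HasDerivAt (U (ℓ - 1)) u' x ∧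
        4 * W (ℓ - 1) x * (U (ℓ - 1) x - W (ℓ - 1) x ^ 2) - u' ≤ 0) →
      (∃ a'' : ℝ, a ≤ a'' ∧ a'' < xf ∧ ∀ x, a'' < x → 0 ≤ U ℓ x) ∧
      AntitoneOn (U ℓ) (Set.Ici xf) ∧
      ∀ t : ℝ, 0 < t → t ^ 2 * U ℓ (xf + t) ≤ 1 / 16 := by
  intro W U ℓ a a' xf _hℓ haa' ha' hW hU h12 h3 h4
  have haxf : a < xf := lt_of_le_of_lt haa' ha'
  refine ⟨⟨a', haa', ha', fun x hx => ?_⟩, ?_, ?_⟩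
  · -- nonnegativity on `(a', ∞)`
    rw [hU x (lt_of_le_of_lt haa' hx)]
    linarith [(h12 x hx).2]
  · -- antitone on `[xf, ∞)`: the derivative of `2W² − U(ℓ−1)` is `4W(U(ℓ−1) − W²) − U(ℓ−1)′ ≤ 0`
    set g : ℝ → ℝ := fun x => 2 * W (ℓ - 1) x ^ 2 - U (ℓ - 1) x with hg
    have hderiv : ∀ x, xf ≤ x → ∃ g' : ℝ, HasDerivAt g g' x ∧ g' ≤ 0 := by
      intro x hx
      obtain ⟨u', hu', hle⟩ := h4 x hx
      have hWx := hW x (lt_of_lt_of_le haxf hx)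
      refine ⟨2 * (2 * W (ℓ - 1) x * (U (ℓ - 1) x - W (ℓ - 1) x ^ 2)) - u', ?_, by nlinarith⟩
      have h1 : HasDerivAt (fun y => W (ℓ - 1) y ^ 2)
          (2 * W (ℓ - 1) x * (U (ℓ - 1) x - W (ℓ - 1) x ^ 2)) x := by
        have h0 : HasDerivAt (fun y => W (ℓ - 1) y * W (ℓ - 1) y)
            ((U (ℓ - 1) x - W (ℓ - 1) x ^ 2) * W (ℓ - 1) x
              + W (ℓ - 1) x * (U (ℓ - 1) x - W (ℓ - 1) x ^ 2)) x := hWx.mul hWx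
        have hfun : (fun y => W (ℓ - 1) y ^ 2) = fun y => W (ℓ - 1) y * W (ℓ - 1) y := by
          funext y; ring
        rw [hfun]
        refine h0.congr_deriv ?_
        ring
      exact (h1.const_mul 2).sub hu'
    have hanti : AntitoneOn g (Ici xf) := by
      refine antitoneOn_of_deriv_nonpos (convex_Ici xf) ?_ ?_ ?_
      · intro x hx
        obtain ⟨g', hg', _⟩ := hderiv x hx
        exact hg'.continuousAt.continuousWithinAt
      · intro x hx
        rw [interior_Ici] at hx
        obtain ⟨g', hg', _⟩ := hderiv x (le_of_lt hx)
        exact hg'.differentiableAt.differentiableWithinAt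
      · intro x hx
        rw [interior_Ici] at hx
        obtain ⟨g', hg', hle⟩ := hderiv x (le_of_lt hx)
        rw [hg'.deriv]
        exact hle
    intro x hx y hy hxy
    have hxU : U ℓ x = g x := hU x (lt_of_lt_of_le haxf hx)
    have hyU : U ℓ y = g y := hU y (lt_of_lt_of_le haxf hy)
    rw [hxU, hyU]
    exact hanti hx hy hxy
  · -- sub-Hardy: terminal identity + mean value inequality (`sq_mul_crum_next_le`)
    intro t ht
    have hW' : ∀ x, xf ≤ x → HasDerivAt (W (ℓ - 1)) (U (ℓ - 1) x - W (ℓ - 1) x ^ 2) x :=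
      fun x hx => hW x (lt_of_lt_of_le haxf hx)
    have hneg : ∀ x, xf ≤ x → W (ℓ - 1) x < 0 := fun x hx => (h12 x (lt_of_lt_of_le ha' hx)).1
    have hge : ∀ x, xf ≤ x →
        (1 / 2 : ℝ) ≤ (U (ℓ - 1) x - W (ℓ - 1) x ^ 2) / W (ℓ - 1) x ^ 2 := by
      intro x hx
      have hW2 : 0 < W (ℓ - 1) x ^ 2 := by
        have h := hneg x hx
        rw [sq]
        exact mul_pos_of_neg_of_neg h h
      rw [le_div_iff₀ hW2]
      linarith [(h3 x hx).1]
    have hle : ∀ x, xf ≤ x →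
        1 - (U (ℓ - 1) x - W (ℓ - 1) x ^ 2) / W (ℓ - 1) x ^ 2 ≤ (1 / 64 : ℝ) := by
      intro x hx
      have hW2 : 0 < W (ℓ - 1) x ^ 2 := by
        have h := hneg x hx
        rw [sq]
        exact mul_pos_of_neg_of_neg h h
      have hrew : 1 - (U (ℓ - 1) x - W (ℓ - 1) x ^ 2) / W (ℓ - 1) x ^ 2
          = (2 * W (ℓ - 1) x ^ 2 - U (ℓ - 1) x) / W (ℓ - 1) x ^ 2 := by
        rw [eq_div_iff hW2.ne', sub_mul, div_mul_cancel₀ _ hW2.ne']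
        ring
      rw [hrew, div_le_iff₀ hW2]
      linarith [(h3 x hx).2]
    have key := Literature.Analysis.ODE.sq_mul_crum_next_le (W := W (ℓ - 1)) (U := U (ℓ - 1))
      hW' hneg (by norm_num : (0 : ℝ) < 1 / 2) (by norm_num : (0 : ℝ) ≤ 1 / 64) hge hle t ht
    have hxt : a < xf + t := by linarith
    rw [hU (xf + t) hxt]
    calc t ^ 2 * (2 * W (ℓ - 1) (xf + t) ^ 2 - U (ℓ - 1) (xf + t))
        ≤ 1 / 64 / (1 / 2) ^ 2 := key
      _ = 1 / 16 := by norm_num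

end Summit.FinalStateConjecture.FinalStateConjecture.Theorems.CrumPeelingRecessiveTower
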